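import Literature.NumberTheory.EllipticCurves.SerreOpenImageFinalProofs
import Literature.NumberTheory.EllipticCurves.SupersingularDensityProofs
import Literature.NumberTheory.EllipticCurves.BSDSelmerPParityNoContinuationProofs
import Summits.BirchSwinnertonDyer.BirchSwinnertonDyer.Theorems.SelmerRankSelmerRankLBStubHeegnerFieldSupply
import HarnessLib

/-!
# Route `KolyvaginDepthDoor`, crux `KolyvaginDepthSupply` (stmt-BirchSwinnertonDyer-21765) —
# the ADMISSIBLE DATA `(p, K)` of the crux exist for every non-CM curve (unconditional)

Helper file (`--supports stmt-BirchSwinnertonDyer-21765 --as helper`), route-independent (no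
`Theses` import); it closes nothing and BSD is not proved by it.

The crux asks, for every non-CM globally minimal `E/ℚ`, for a prime `p ≥ 5` of good ORDINARY
reduction with `ρ̄_{E,p}` SURJECTIVE, an imaginary quadratic `K` with `d_K ∉ {−3, −4}`,
`p ∤ d_K`, `p ∤ N_E` and the Heegner hypothesis for `N_E`, and then a non-zero Kolyvagin–Heegner
class of the right depth. The route's first KILL CRITERION reads: "a non-CM curve with NO prime
`p ≥ 5` that is simultaneously good, ordinary, of surjective mod-`p` image and prime to some
Heegner discriminant `≠ −3, −4` refutes `KolyvaginDepthSupply` as MISSTATED". This file proves,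
UNCONDITIONALLY, that no such curve exists — the admissible data are never the obstruction:

* `exists_admissiblePrime_heegnerField_of_not_hasCM` — every non-CM globally minimal elliptic
  `E/ℚ` has a prime `p ≥ 5` of good ordinary reduction with `ρ̄_{E,p}` onto (Serre's open image
  theorem `serre_open_image_holds` + infinitely many good ordinary primes
  `infinite_goodOrdinaryPrimes_holds`, both DISCHARGED tree theorems) and an imaginary quadratic
  `K` with the Heegner hypothesis for `N_E`, in which `2` and `p` split — hence `d_K` odd,
  `d_K ∉ {−3, −4}`, `p ∤ d_K` (`heegnerField_discr_conditions`) — (Dirichlet: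
  `exists_isImaginaryQuadratic_satisfiesHeegnerHypothesis` at level `2 p N_E`), with `p ∤ N_E`
  (good reduction) and `N_E ≠ 0`. These are simultaneously the standing hypotheses of Kolyvagin
  1991 Thm. 4 (`Kolyvagin1991_selmerCorank_of_kolyvaginClass_ne_zero`) and — with (irr), (tor)
  implied by surjectivity — of BCGS 2026 Thm. 1 (`BurungaleEtAl2026_exists_kolyvaginClass_ne_zero`).
* `exists_admissiblePrime_heegnerField_gt_of_not_hasCM` — the same with `p` larger than any
  given bound (the admissible primes are cofinite among the good ordinary ones).

So the open content of the crux is entirely in the class `c_M(n) ≠ 0` and its depth (X1 on non-CM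
curves, by the companion files `KolyvaginDepthDoorKolyvaginDepthSupplyDoor` / `…RankTwo`), never
in the existence of `(p, K)`.

References: [Serre1972] J.-P. Serre, Invent. Math. 15 (1972), §4.2 Thm. 2; [Serre1981] Publ. IHÉS
54, §8; [Gross1984] B. H. Gross, *Heegner points on X₀(N)*, §3 (existence of Heegner fields);
[GrossLMS1991] §1.
-/

set_option linter.dupNamespace false

noncomputable section

open scoped Classical

namespace Summit.BirchSwinnertonDyer.BirchSwinnertonDyer.Theorems.KolyvaginDepthDoor

open Literature.NumberTheory.EllipticCurves Literature.NumberTheory.EllipticCurves.ModularForms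
  WeierstrassCurve
open Summit.BirchSwinnertonDyer.BirchSwinnertonDyer.Theorems

/-- **Admissible `(p, K)` above any bound, unconditionally.** For a non-CM globally minimal
elliptic `E/ℚ` and any `B`, there are a prime `p > B`, `p ≥ 5`, of good ordinary reduction with
`ρ̄_{E,p}` surjective, and an imaginary quadratic field `K` satisfying the Heegner hypothesis for
`N_E = W.conductorNorm ℤ`, for `2` and for `p` (both split), with `d_K ≠ −3`, `d_K ≠ −4`, `d_K`
odd, `p ∤ d_K`, `p ∤ N_E`, `N_E ≠ 0`. Proof: Serre's open image theorem (`serre_open_image_holds`: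
surjectivity for all `p ≥ p₀(E)`) and the infinitude of good ordinary primes
(`infinite_goodOrdinaryPrimes_holds`) give `p`; Dirichlet's theorem gives an imaginary quadratic
`K` with every prime factor of `2 p N_E` split (`exists_isImaginaryQuadratic_satisfiesHeegnerHypothesis`),
and `2`, `p` split yield the discriminant conditions (`heegnerField_discr_conditions`).
Unconditional. [cite: Serre1972, §4.2 Thm. 2] [cite: Gross1984, §3] -/
theorem exists_admissiblePrime_heegnerField_gt_of_not_hasCM (W : WeierstrassCurve ℚ) [W.IsElliptic]
    [W.IsGloballyMinimal] (hW : ¬ W.HasCM) (B : ℕ) :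
    ∃ (p : ℕ) (_ : Fact p.Prime), B < p ∧ 5 ≤ p ∧ W.HasGoodReductionAtPrime p ∧
      ¬ (p : ℤ) ∣ W.frobeniusTrace p ∧ W.HasSurjectiveModNGaloisRep p ∧
      ∃ (K : Type) (_ : Field K) (_ : NumberField K), IsImaginaryQuadratic K ∧
        NumberField.discr K ≠ -3 ∧ NumberField.discr K ≠ -4 ∧
        ¬ ((p : ℤ) ∣ NumberField.discr K) ∧ ¬ (p ∣ W.conductorNorm ℤ) ∧
        NeZero (W.conductorNorm ℤ) ∧ SatisfiesHeegnerHypothesis (W.conductorNorm ℤ) K ∧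
        Odd (NumberField.discr K) ∧ SatisfiesHeegnerHypothesis 2 K ∧
        SatisfiesHeegnerHypothesis p K := by
  -- the prime: Serre + infinitely many good ordinary primes
  obtain ⟨p₀, hp₀⟩ := serre_open_image_holds W hW
  obtain ⟨p, ⟨hp, hgood, hord⟩, hlt⟩ :=
    (WeierstrassCurve.infinite_goodOrdinaryPrimes_holds W).exists_gt (max (max p₀ 4) B)
  have h5 : 5 ≤ p := by
    have := le_max_right p₀ 4
    have := le_max_left (max p₀ 4) B
    omega
  have hle : p₀ ≤ p := by
    have := le_max_left p₀ 4
    have := le_max_left (max p₀ 4) B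
    omega
  have hB : B < p := by
    have := le_max_right (max p₀ 4) B
    omega
  have hpP : p.Prime := hp.out
  have hsurj : W.HasSurjectiveModNGaloisRep p := hp₀ p hpP hle
  have hpN : ¬ (p ∣ W.conductorNorm ℤ) := fun h ↦
    (W.dvd_conductorNorm_iff_not_hasGoodReductionAtPrime p).mp h hgood
  have hN0 : W.conductorNorm ℤ ≠ 0 := (W.conductorNorm_pos_holds).ne'
  -- the field: Dirichlet at level `2 p N_E`
  have hL : 2 * p * W.conductorNorm ℤ ≠ 0 :=
    mul_ne_zero (mul_ne_zero two_ne_zero hpP.ne_zero) hN0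
  obtain ⟨K, iF, iN, hK, -, hH⟩ := exists_isImaginaryQuadratic_satisfiesHeegnerHypothesis hL 0
  have hHN : SatisfiesHeegnerHypothesis (W.conductorNorm ℤ) K :=
    hH.of_dvd (dvd_mul_left _ _)
  have hH2 : SatisfiesHeegnerHypothesis 2 K :=
    hH.of_dvd ((dvd_mul_right 2 p).trans (dvd_mul_right _ _))
  have hHp : SatisfiesHeegnerHypothesis p K :=
    hH.of_dvd ((dvd_mul_left p 2).trans (dvd_mul_right _ _))
  obtain ⟨hne3, hne4, hnp, hodd⟩ := heegnerField_discr_conditions hK hH2 hpP hHp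
  exact ⟨p, hp, hB, h5, hgood, hord, hsurj, K, iF, iN, hK, hne3, hne4, hnp, hpN, ⟨hN0⟩, hHN, hodd,
    hH2, hHp⟩

/-- **The admissible data of `KolyvaginDepthSupply` are never empty (unconditional).** Every
non-CM globally minimal elliptic `E/ℚ` has a prime `p ≥ 5` of good ordinary reduction with
`ρ̄_{E,p}` surjective and an imaginary quadratic `K` with `d_K ≠ −3, −4`, `p ∤ d_K`, `p ∤ N_E`,
`N_E ≠ 0` and the Heegner hypothesis for `N_E` — exactly the data the crux quantifies before its
Kolyvagin–Heegner class — and moreover `d_K` odd and `p` split in `K` (the extra standing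
hypotheses of BCGS 2026 Thm. 1). Hence the route's kill criterion "no admissible `(p, K)`" can never
fire: the crux cannot be misstated on that account, and its open content is the non-vanishing
`c_M(n) ≠ 0` at the right depth alone. Unconditional (Serre's open image theorem and the density
of ordinary primes are discharged tree theorems; the field is Dirichlet's theorem).
[cite: Serre1972, §4.2 Thm. 2] [cite: Gross1984, §3] -/
theorem exists_admissiblePrime_heegnerField_of_not_hasCM (W : WeierstrassCurve ℚ) [W.IsElliptic]
    [W.IsGloballyMinimal] (hW : ¬ W.HasCM) :
    ∃ (p : ℕ) (_ : Fact p.Prime), 5 ≤ p ∧ W.HasGoodReductionAtPrime p ∧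
      ¬ (p : ℤ) ∣ W.frobeniusTrace p ∧ W.HasSurjectiveModNGaloisRep p ∧
      ∃ (K : Type) (_ : Field K) (_ : NumberField K), IsImaginaryQuadratic K ∧
        NumberField.discr K ≠ -3 ∧ NumberField.discr K ≠ -4 ∧
        ¬ ((p : ℤ) ∣ NumberField.discr K) ∧ ¬ (p ∣ W.conductorNorm ℤ) ∧
        ∃ (_ : NeZero (W.conductorNorm ℤ)),
          SatisfiesHeegnerHypothesis (W.conductorNorm ℤ) K ∧
          Odd (NumberField.discr K) ∧ SatisfiesHeegnerHypothesis p K := by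
  obtain ⟨p, hp, -, h5, hgood, hord, hsurj, K, iF, iN, hK, hne3, hne4, hnp, hpN, hNZ, hHN, hodd, -,
    hHp⟩ := exists_admissiblePrime_heegnerField_gt_of_not_hasCM W hW 0
  exact ⟨p, hp, h5, hgood, hord, hsurj, K, iF, iN, hK, hne3, hne4, hnp, hpN, hNZ, hHN, hodd, hHp⟩

end Summit.BirchSwinnertonDyer.BirchSwinnertonDyer.Theorems.KolyvaginDepthDoor

end
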